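import Summits.BirchSwinnertonDyer.BirchSwinnertonDyer.Theorems.ByReductionTypeAtTwoMultTransportTwistedDescentLocalPackageInertia
import Summits.BirchSwinnertonDyer.BirchSwinnertonDyer.Theorems.ByReductionTypeAtTwoMultTransportTwistedDescentOrdLinePackage
import Summits.BirchSwinnertonDyer.BirchSwinnertonDyer.Theorems.ByReductionTypeAtTwoMultTransportData
import Summits.BirchSwinnertonDyer.BirchSwinnertonDyer.Theorems.ByReductionTypeAtTwoMultTransportKlein
import Literature.NumberTheory.EllipticCurves.Greenberg1999.TwoTorsionLinesTateProofs
import Literature.NumberTheory.EllipticCurves.Greenberg1999.TwoTorsionLinesProofs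
import Literature.NumberTheory.EllipticCurves.SelmerCorankProofs
import HarnessLib

/-!
# T-42 in the kernel, LXXXVI — road (S-C′): the MODEL HYPOTHESIS `hmod₁` «no `Γ_ℚ`-fixed point of order `2` on the line» IN CLOSED
# FORM — Greenberg's §5 dictionary (F4T / F4G, kernel) turns it into the decidable TYPE-B side condition `¬ TwoTorsionRamifiedAtTwo x`
# (`v₂(x(P₀)) ≥ 0`, i.e. `P₀ ∉ C₂`) on a curve with exactly one rational point of order `2`

Cell `bsd-2adic` (run/shared/lean/pub/bsd-2adic/), seat `bsd-2adic-t42` GEN 33 (pen RC-521 (3) / RC-528 SUMMON «B3/B4 … hmod₁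
DISPLAYED», memo `t42/DESIGN-T42-ADDENDUM-36.md` §A36.3: «hmod₁ … to be discharged per model: ℤ/2-rows: HasUniqueRationalTwoTorsion ∧
P₀ ∉ N.plus (Tate line: x(P₀) ∈ ℤ₂; reduction datum: P₀ ∉ E₁(ℚ₂))»). HONEST FRAMING: research route; THEOREMS ONLY (no `def`, no named
fact, no instance, no `sorry`); nothing booked; no door or class file is touched; BSD is not proved by any of this. PARTITION: X5@2
multiplicative GV-transport rows (K4ᵐ B1·O1) × p = 2 — reduces-the-named-input-of (F1); bears_on K4 items 19922 / 19923
(`--supports stmt-BirchSwinnertonDyer-19923`).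

## What

* §1 **`exists_tateLine_package_dict_two`** — XXXVII's Tate line package at the prime `2` of a globally minimal `E/ℚ` with multiplicative
  reduction (`N`, (d) divisible, (c) `#N[2] = 2`, (i) `N`-valued cocycles of `(ker κ)_v` Kummer, (iv) inertia acts on `N ∩ E[2^n]` through
  its `μ_{2^n}`-exponent) TOGETHER WITH Greenberg's §5 dictionary for the SAME line: for a rational point `P = (x, y)` of order `2`,
  `ι(P) ∈ N.plus ↔ TwoTorsionRamifiedAtTwo x` — the kernel theorem F4T `Greenberg1999.twoTorsion_mem_tateLine_iff_ramifiedAtTwo_holds`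
  applied to the twisted Tate uniformisation `Ψ` from which `N = tateDatum W 2 Ψ` is built (`exists_twistedTateUniformisation_tateJ`).
  Proof body = XXXVII `exists_tateLine_localKummer_two_inertia` (components (ii), (iii) dropped) + one line.
* §2 **`forall_mem_plus_two_smul_eq_zero_fixed_eq_zero_of_not_ramified`** — for ANY local datum `N` carrying that dictionary at the
  rational `2`-torsion point `(x, y)` of a curve with `HasUniqueRationalTwoTorsionX W x` and `¬ TwoTorsionRamifiedAtTwo x` (type B:
  `x(P₀) ∈ ℤ₂`, `P₀ ∉ C₂`), the model hypothesis `hmod₁` of LXXIX–LXXXV holds: every `Γ_ℚ`-fixed `P ∈ N.plus` with `2 • P = 0` is `0`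
  (Galois descent `WeierstrassCurve.exists_toGeomPoints_eq_of_forall_smul_eq`: a fixed point is rational; a rational point of order `2`
  has abscissa `x` by uniqueness; the dictionary says it is NOT on the line).
* §3 **`reductionDatum_package_dict_two`** — the good-ordinary twin: LXIII `reductionDatum_linePackage` + the dictionary F4G
  (`Greenberg1999.twoTorsion_mem_kernelReduction_iff_ramifiedAtTwo_holds` through `MultTransportAtTwo.reductionData_package_two`) for
  Greenberg's datum `C₂ = ker(E[2^∞] → Ẽ)`.

References: [GreenbergLNM1716] §2 Props. 2.2, 2.4 (pp. 70–76), §5 p. 168 («ramified at 2»), pp. 174–176; [GreenbergVatsal2000] §2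
pp. 14–16; [SilvermanATAEC1994] V Thm. 3.1 (c), Lemma 5.2 (c), Thm. 5.3, Ex. 5.11; [SilvermanAEC2009] VII.2, VIII.1.
-/

set_option autoImplicit false
set_option linter.dupNamespace false

noncomputable section

open scoped Classical AddSubgroup

namespace Summit.BirchSwinnertonDyer.BirchSwinnertonDyer.Theorems.MultTransportTwistedDescent

open NumberField IsDedekindDomain Field WeierstrassCurve
  Literature.NumberTheory.GaloisRepresentations Literature.NumberTheory.EllipticCurves
  Literature.NumberTheory.EllipticCurves.GreenbergSelmer IsDedekindDomain.HeightOneSpectrum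
  Literature.NumberTheory.EllipticCurves.TateCurve Literature.NumberTheory.EllipticCurves.Greenberg1999
  Summit.BirchSwinnertonDyer.Rank1Residual Summit.BirchSwinnertonDyer.Rank1Residual.X2
  Summit.BirchSwinnertonDyer.Rank1Residual.X2.GreenbergVatsalReductionDatum

variable (W : WeierstrassCurve ℚ) [W.IsElliptic] [W.IsGloballyMinimal] (κ : ZpExtension ℚ 2)
  {v : HeightOneSpectrum (𝓞 ℚ)}

/-! ## §1. The Tate line package at `2` WITH Greenberg's §5 dictionary -/

/-- **The Tate line package at the prime `2` of the minimal `E/ℚ` with multiplicative reduction, with the §5 dictionary**: a line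
`N ⊆ E[2^∞]` at `v ∋ 2` (a `LocalDatum`), (d) `2`-divisible, (c) `#(N ∩ E[2]) = 2`, (i) every continuous `N`-valued crossed homomorphism
of `(ker κ)_v` is a Kummer coboundary, (iv) every `σ ∈ I_{ℚ_v}` acting on `μ_{2^n}` as `ζ ↦ ζ^a` acts on `N ∩ E[2^n]` as `c ↦ a • c`, AND
(v) for the rational point `P = (x, y)` of order `2`: `ι(P) ∈ N ↔ TwoTorsionRamifiedAtTwo x` (`v₂(x) < 0`; Greenberg §5 p. 168 / p. 176,
the kernel theorem `twoTorsion_mem_tateLine_iff_ramifiedAtTwo_holds` for the same twisted Tate parametrisation `Ψ`).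
[cite: GreenbergLNM1716, §2 Prop. 2.4 (pp. 74–75), §5 p. 168 and p. 176] [cite: GreenbergVatsal2000, §2 pp. 14–15]
[cite: SilvermanATAEC1994, Thm. V.3.1 (c), Lemma V.5.2 (c), Thm. V.5.3, Ex. 5.11] -/
theorem exists_tateLine_package_dict_two (hκ : κ.IsCyclotomic)
    (hmult : W.HasMultiplicativeReductionAtPrime 2) (hv2 : ((2 : ℕ) : 𝓞 ℚ) ∈ v.asIdeal)
    {x y : ℚ} (hxy : W.toAffine.Nonsingular x y) (h2 : 2 * y + W.a₁ * x + W.a₃ = 0) :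
    ∃ N : LocalDatum ℚ (W.geomPrimaryTorsion 2) v,
      (∀ c ∈ N.plus, ∃ c' ∈ N.plus, 2 • c' = c) ∧
      Nat.card ↥(N.plus ⊓ (↥(W.geomPrimaryTorsion 2))[(2 : ℤ)]) = 2 ∧
      (∀ (f : localSubgroup κ.kerSubgroup (v.adicCompletion ℚ) → W.geomPrimaryTorsion 2),
        (∀ τ, f τ ∈ N.plus) → Continuous f →
        (∀ τ₁ τ₂, f (τ₁ * τ₂) = f τ₁ + resGal (K := ℚ) (v.adicCompletion ℚ)
          (τ₁ : absoluteGaloisGroup (v.adicCompletion ℚ)) • f τ₂) →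
        ∃ Q : localPoints W (v.adicCompletion ℚ),
          ∀ τ : localSubgroup κ.kerSubgroup (v.adicCompletion ℚ),
            pointsMap W (v.adicCompletion ℚ) (f τ : W.geomPoints) =
              (τ : absoluteGaloisGroup (v.adicCompletion ℚ)) • Q - Q) ∧
      (∀ σ ∈ absInertia (v.adicCompletion ℚ), ∀ (n a : ℕ),
        (∀ ζ : (AlgebraicClosure (v.adicCompletion ℚ))ˣ, ζ ^ 2 ^ n = 1 →
          Units.map (Field.absoluteGaloisGroup.toAlgEquiv (v.adicCompletion ℚ) σ :
            AlgebraicClosure (v.adicCompletion ℚ) →* AlgebraicClosure (v.adicCompletion ℚ)) ζ = ζ ^ a) →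
        ∀ c ∈ N.plus, 2 ^ n • c = 0 →
          resGal (K := ℚ) (v.adicCompletion ℚ) σ • c = a • c) ∧
      (∀ m : W.geomPrimaryTorsion 2, (m : W.geomPoints) = toGeomPoints W (.some x y hxy) →
        (m ∈ N.plus ↔ TwoTorsionRamifiedAtTwo x)) := by
  have hv : W.HasMultiplicativeReductionAt v :=
    GreenbergVatsalStrictSelmerMultiplicative.hasMultiplicativeReductionAt_of_mem W 2 hmult hv2
  obtain ⟨q, t, Ψ, hq0, hq1, -, -, -, ht2, hsurj, hker, hΨσ⟩ := exists_twistedTateUniformisation_tateJ W v hv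
  have hts := X2.GreenbergVatsalTateKummer.smul_sqrt_eq_or W t ht2
  have hΦ : ∀ (σ : absoluteGaloisGroup (v.adicCompletion ℚ))
      (u : (AlgebraicClosure (v.adicCompletion ℚ))ˣ),
      σ • Ψ (Additive.ofMul u) = Ψ (Additive.ofMul (Units.map
        (Field.absoluteGaloisGroup.toAlgEquiv (v.adicCompletion ℚ) σ :
          AlgebraicClosure (v.adicCompletion ℚ) →* AlgebraicClosure (v.adicCompletion ℚ)) u)) ∨
      σ • Ψ (Additive.ofMul u) = -Ψ (Additive.ofMul (Units.map
        (Field.absoluteGaloisGroup.toAlgEquiv (v.adicCompletion ℚ) σ :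
          AlgebraicClosure (v.adicCompletion ℚ) →* AlgebraicClosure (v.adicCompletion ℚ)) u)) := by
    intro σ u
    rw [hΨσ σ u]
    split_ifs
    · exact Or.inl (one_zsmul _)
    · exact Or.inr (by rw [neg_one_zsmul])
  refine ⟨GreenbergVatsalTateDatum.tateDatum W 2 Ψ hΦ,
    GreenbergVatsalTateDatumCofree.tateDatum_plus_divisible W 2 Ψ hΦ,
    GreenbergVatsalTateDatumCofree.natCard_tateDatum_plus_inf_torsionBy W 2 Ψ hΦ hq0 hq1
      (fun u h ↦ (hker u).1 h), ?_, ?_, ?_⟩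
  · intro f hfC hfcont hfcoc
    exact exists_kummerPoint_of_cocycle_mem_plus W 2 κ Ψ t hq0 hq1 (fun u h ↦ (hker u).1 h) hΨσ hts
      _ (GreenbergVatsalTateDatum.mem_tateDatum_plus_iff hΦ) hκ f hfC hfcont hfcoc
  · intro σ hσ n a hroots c hc hcn
    haveI : CharZero (v.adicCompletion ℚ) := charZero_adicCompletion v
    obtain ⟨ζ, hζfin, hζc⟩ := (GreenbergVatsalTateDatum.mem_tateDatum_plus_iff hΦ c).1 hc
    -- `ζ ^ 2^n ∈ q^ℤ ∩ μ = 1`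
    have hζn : ζ ^ 2 ^ n = 1 := by
      have h0 : Ψ (Additive.ofMul (ζ ^ 2 ^ n)) = 0 := by
        rw [ofMul_pow, map_nsmul, hζc, ← map_nsmul, ← AddSubmonoidClass.coe_nsmul, hcn, ZeroMemClass.coe_zero,
          map_zero]
      exact X2.GreenbergVatsalTateKummerLocal.eq_one_of_isOfFinOrder_of_map_eq_zero W Ψ (fun u h ↦ (hker u).1 h)
        hq0 hq1 (hζfin.pow) h0
    -- inertia fixes `t` at the prime `2`
    have hσt : Field.absoluteGaloisGroup.toAlgEquiv (v.adicCompletion ℚ) σ t = t :=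
      TateTwistUnramifiedAtTwo.inertia_fix_sqrt_gamma_two W hmult hv2 t ht2 σ hσ
    apply GreenbergVatsalTateDatumCofree.pointsMap_coe_injective W 2 (v := v)
    dsimp only
    rw [primaryComponent.coe_smul, pointsMap_smul, AddSubmonoidClass.coe_nsmul, map_nsmul, ← hζc, hΨσ σ ζ,
      if_pos hσt, one_zsmul, hroots ζ hζn, ofMul_pow, map_nsmul]
  · -- (v) the §5 dictionary for the same `Ψ`
    intro m hm
    rw [GreenbergVatsalTateDatum.mem_tateDatum_plus_iff hΦ m, hm]
    exact twoTorsion_mem_tateLine_iff_ramifiedAtTwo_holds W hmult v hv2 q t Ψ hq0 hq1 ht2 hsurj hker hΨσ x y hxy h2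

/-! ## §2. `hmod₁` from the type-B side condition `¬ TwoTorsionRamifiedAtTwo x` -/

omit [W.IsGloballyMinimal] in
/-- **The model hypothesis `hmod₁` in closed form.** `E/ℚ` with EXACTLY ONE rational point `P₀ = (x, y)` of order `2`
(`HasUniqueRationalTwoTorsionX W x`), a local datum `N` at `v` whose line satisfies the §5 dictionary at `P₀`
(`ι(P₀) ∈ N.plus ↔ TwoTorsionRamifiedAtTwo x`), and the TYPE-B side condition `¬ TwoTorsionRamifiedAtTwo x` (`v₂(x) ≥ 0`: `P₀ ∉ C₂`).
THEN every `Γ_ℚ`-fixed `P ∈ N.plus` with `2 • P = 0` vanishes: a fixed geometric point is rational (Galois descent,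
`WeierstrassCurve.exists_toGeomPoints_eq_of_forall_smul_eq`), a non-zero rational point killed by `2` is `(x₁, y₁)` with
`2y₁ + a₁x₁ + a₃ = 0`, so `x₁ = x` and `y₁ = y` by uniqueness, and the dictionary puts it OFF the line.
[cite: GreenbergLNM1716, §5 p. 168 and p. 176] [cite: SilvermanAEC2009, VIII.1 and Prop. III.2.3] -/
theorem forall_mem_plus_two_smul_eq_zero_fixed_eq_zero_of_not_ramified
    (N : LocalDatum ℚ (W.geomPrimaryTorsion 2) v) {x y : ℚ} (hx : HasUniqueRationalTwoTorsionX W x)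
    (hxy : W.toAffine.Nonsingular x y) (h2 : 2 * y + W.a₁ * x + W.a₃ = 0)
    (hdict : ∀ m : W.geomPrimaryTorsion 2, (m : W.geomPoints) = toGeomPoints W (.some x y hxy) →
      (m ∈ N.plus ↔ TwoTorsionRamifiedAtTwo x))
    (hB : ¬ TwoTorsionRamifiedAtTwo x) :
    ∀ P ∈ N.plus, 2 • P = 0 → (∀ g : absoluteGaloisGroup ℚ, g • P = P) → P = 0 := by
  intro P hP h2P hfix
  -- the rational point `P₀ = (x, y)` of order `2` inside `E[2](ℚ̄)`
  obtain ⟨y₁, h, P₀, hP₀, -, -, h2₁⟩ := MultTransportAtTwo.exists_geomTorsion_two_of_hasRationalTwoTorsionX W hx.1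
  obtain rfl : y₁ = y := by linarith
  have hP₀g : (P₀ : W.geomPoints) = toGeomPoints W (.some x y₁ hxy) := by
    rw [hP₀]
    exact (MultTransportAtTwo.some_eq_some_geomPoints W (X₁ := algebraMap ℚ (AlgebraicClosure ℚ) x)
      (Y₁ := algebraMap ℚ (AlgebraicClosure ℚ) y₁)
      (h₁ := (WeierstrassCurve.Affine.baseChange_nonsingular (W := W.toAffine)
        (Algebra.ofId ℚ (AlgebraicClosure ℚ)).injective ..).mpr hxy)
      (eq_ratCast _ x) (eq_ratCast _ y₁)).symm
  -- `P` as a `Γ_ℚ`-fixed element `T ∈ E[2](ℚ̄)`: it is `0` or `P₀`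
  have hPP : (P : W.geomPoints) + P = 0 := by
    rw [← AddSubgroup.coe_add, ← two_nsmul, h2P, ZeroMemClass.coe_zero]
  have hT2 : (P : W.geomPoints) ∈ W.geomTorsion 2 := by
    rw [WeierstrassCurve.mem_geomTorsion_iff, two_zsmul]
    exact hPP
  have hTfix : ∀ σ : absoluteGaloisGroup ℚ,
      σ • (⟨(P : W.geomPoints), hT2⟩ : W.geomTorsion 2) = ⟨(P : W.geomPoints), hT2⟩ := by
    intro σ
    apply Subtype.ext
    rw [AddSubgroup.torsionBy.coe_smul]
    change σ • (P : W.geomPoints) = P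
    rw [← primaryComponent.coe_smul, hfix σ]
  rcases MultTransportAtTwo.eq_zero_or_eq_of_smul_eq W hx h h2₁ hP₀ hTfix with h0 | hT
  · exact Subtype.ext (congrArg Subtype.val h0 :)
  · -- `P = P₀` lies on the line: the dictionary says `v₂(x) < 0`, contradiction
    have hPg : (P : W.geomPoints) = toGeomPoints W (.some x y₁ hxy) := by
      rw [← hP₀g]; exact congrArg Subtype.val hT
    exact absurd ((hdict P hPg).1 hP) hB

/-! ## §3. The good-ordinary twin: Greenberg's datum `C₂ = ker(E[2^∞] → Ẽ)` with its dictionary -/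

/-- **The reduction-datum line package at a GOOD ORDINARY `2` WITH the §5 dictionary**: for a globally minimal `E/ℚ` with `2 ∤ Δ_E`,
`2 ∤ a₂` and the cyclotomic `ℤ₂`-extension `κ`, Greenberg's datum `N = reductionDatum W 2` at `v ∋ 2` has (d), (c), (i), (iv) (LXIII
`reductionDatum_linePackage`) and (v) `ι(P) ∈ N.plus ↔ TwoTorsionRamifiedAtTwo x` for the rational point `P = (x, y)` of order `2` (the
kernel theorem F4G `twoTorsion_mem_kernelReduction_iff_ramifiedAtTwo_holds` through `MultTransportAtTwo.reductionData_package_two`).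
[cite: GreenbergLNM1716, §2 Props. 2.2, 2.4 (pp. 70–76), §5 p. 168 and p. 176] [cite: GreenbergVatsal2000, §2 pp. 14, 16, 26]
[cite: SilvermanAEC2009, VII.2] -/
theorem reductionDatum_package_dict_two (hκ : κ.IsCyclotomic) (hv2 : ((2 : ℕ) : 𝓞 ℚ) ∈ v.asIdeal)
    (hgood : W.HasGoodReductionAtPrime 2) (hord : ¬ (2 : ℤ) ∣ W.frobeniusTrace 2)
    (hΔ2 : ¬ ((2 : ℕ) : ℤ) ∣ W.minimalDiscriminantInt)
    {x y : ℚ} (hxy : W.toAffine.Nonsingular x y) (h2 : 2 * y + W.a₁ * x + W.a₃ = 0) :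
    (∀ c ∈ (reductionDatum W 2 hv2 hΔ2).plus, ∃ c' ∈ (reductionDatum W 2 hv2 hΔ2).plus, 2 • c' = c) ∧
    Nat.card ↥((reductionDatum W 2 hv2 hΔ2).plus ⊓ (↥(W.geomPrimaryTorsion 2))[(2 : ℤ)]) = 2 ∧
    (∀ (f : localSubgroup κ.kerSubgroup (v.adicCompletion ℚ) → W.geomPrimaryTorsion 2),
      (∀ τ, f τ ∈ (reductionDatum W 2 hv2 hΔ2).plus) → Continuous f →
      (∀ τ₁ τ₂, f (τ₁ * τ₂) = f τ₁ + resGal (K := ℚ) (v.adicCompletion ℚ)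
        (τ₁ : absoluteGaloisGroup (v.adicCompletion ℚ)) • f τ₂) →
      ∃ Q : localPoints W (v.adicCompletion ℚ),
        ∀ τ : localSubgroup κ.kerSubgroup (v.adicCompletion ℚ),
          pointsMap W (v.adicCompletion ℚ) (f τ : W.geomPoints) =
            (τ : absoluteGaloisGroup (v.adicCompletion ℚ)) • Q - Q) ∧
    (∀ σ ∈ absInertia (v.adicCompletion ℚ), ∀ (n a : ℕ),
      (∀ ζ : (AlgebraicClosure (v.adicCompletion ℚ))ˣ, ζ ^ 2 ^ n = 1 →
        Units.map (Field.absoluteGaloisGroup.toAlgEquiv (v.adicCompletion ℚ) σ :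
          AlgebraicClosure (v.adicCompletion ℚ) →* AlgebraicClosure (v.adicCompletion ℚ)) ζ = ζ ^ a) →
      ∀ c ∈ (reductionDatum W 2 hv2 hΔ2).plus, 2 ^ n • c = 0 →
        resGal (K := ℚ) (v.adicCompletion ℚ) σ • c = a • c) ∧
    (∀ m : W.geomPrimaryTorsion 2, (m : W.geomPoints) = toGeomPoints W (.some x y hxy) →
      (m ∈ (reductionDatum W 2 hv2 hΔ2).plus ↔ TwoTorsionRamifiedAtTwo x)) := by
  haveI : Fact (Nat.Prime 2) := ⟨Nat.prime_two⟩
  have hord' : ¬ ((2 : ℕ) : ℤ) ∣ W.frobeniusTrace 2 := by exact_mod_cast hord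
  have hΔ2' : ¬ (2 : ℤ) ∣ W.minimalDiscriminantInt := by exact_mod_cast hΔ2
  obtain ⟨hdiv, hcard, hKum, -, hInert⟩ := reductionDatum_linePackage W 2 κ hκ hv2 hΔ2 hord'
  obtain ⟨-, -, hline⟩ := MultTransportAtTwo.reductionData_package_two W
    twoTorsion_mem_kernelReduction_iff_ramifiedAtTwo_holds hgood hord hΔ2' hxy h2
  exact ⟨hdiv, hcard, hKum, hInert, fun m hm ↦ hline v hv2 m hm⟩

end Summit.BirchSwinnertonDyer.BirchSwinnertonDyer.Theorems.MultTransportTwistedDescent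

end
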